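import Mathlib
import HarnessLib
import Summits.SmoothPoincare4.Statement
import Literature.Geometry.Symplectic.SteinDomain
import Literature.Geometry.Symplectic.SteinBoundaryContact
import Literature.Geometry.Symplectic.PlanarContactBoundary
import Literature.AlgebraicTopology.SingularHomology.SingularChains

/-!
# SmoothPoincare4 / ConvexBisection — sector glue for `AcyclicBisectionRigidity`, structural form

Settles item stmt-SmoothPoincare4-14770 (support `AcyclicRigidityBySectors` of route ConvexBisection):

  `PlanarBisectionRigidity → ContractibleTwistedDoubleStandard → ResidualAcyclicBisectionRigidity
    → AcyclicBisectionRigidity`,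

i.e. crux 2 of the route (a Hausdorff second-countable `C^∞` 4-manifold `M ≃ₕ S⁴` carrying a Stein
bisection along a common contact seam with rationally acyclic halves is diffeomorphic to `S⁴`)
follows from its three sectors: planar seam (crux 5 `PlanarBisectionRigidity`), both halves
contractible (crux 4 `ContractibleTwistedDoubleStandard`, applied to `X := M`, which is compact as
the union of the two compact embedded images), and the residual sector (crux 6
`ResidualAcyclicBisectionRigidity`: seam not planar and halves not both contractible).

The statement below is, token for token, `(body of PlanarBisectionRigidity) → (body of
ContractibleTwistedDoubleStandard) → (body of ResidualAcyclicBisectionRigidity) → (body of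
AcyclicBisectionRigidity)` as printed in the route file
`Summits/SmoothPoincare4/SmoothPoincare4/Theses/ConvexBisection.lean`, so that the gate can link it
there as `theorem AcyclicRigidityBySectors_holds : AcyclicRigidityBySectors := _root_.<this theorem>`
(definitional unfolding of the five route definitions).

Design choice (as for the route's assembly, `Theorems/ConvexBisectionAssemblyStructural.lean`, and
per the planner's note on this item): this module deliberately does NOT import the route file
`Summits.SmoothPoincare4.SmoothPoincare4.Theses.ConvexBisection` — the gate auto-imports the closing
module into that Theses file, and a Theses import here would close an import cycle.  Imports are the
problem statement plus the Literature modules providing `SteinStructure`, `contactPlane`,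
`PlanarContactBoundary` and `singularHomology`.

Proof: pure logic — fix `M`, `e : M ≃ₕ S⁴` and a rationally acyclic Stein bisection
`(W₁, W₂, J₁, J₂, e₁, e₂)` of `M`; case on `PlanarContactBoundary J₁` (then the planar sector
applies to the same witness), else on `ContractibleSpace W₁ ∧ ContractibleSpace W₂` (then
`M = e₁(W₁) ∪ e₂(W₂)` is compact, `isCompact_range` twice, and the contractible sector applies with
`X := M`), else the residual sector applies to the same witness with the two negations appended.
No named facts, no classical axioms beyond `by_cases`.
-/

open scoped Manifold ContDiff
open ContinuousMap


namespace Summit.SmoothPoincare4.SmoothPoincare4.Theorems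

/-- Settles stmt-SmoothPoincare4-14770 (support `AcyclicRigidityBySectors` of route ConvexBisection,
structural form): if (planar sector) every Hausdorff second-countable smooth 4-manifold `M ≃ₕ S⁴`
with a Stein bisection along a common contact seam whose `J₁`-induced boundary contact structure is
planar is diffeomorphic to `S⁴`, and (contractible sector) every compact such 4-manifold that is a
Stein bisection along a common contact seam of two compact contractible Stein domains is
diffeomorphic to `S⁴`, and (residual sector) every `M ≃ₕ S⁴` with a rationally acyclic Stein
bisection whose seam is not planar and whose halves are not both contractible is diffeomorphic to
`S⁴`, then every `M ≃ₕ S⁴` with a rationally acyclic Stein bisection along a common contact seam is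
diffeomorphic to `S⁴`.  Verbatim `PlanarBisectionRigidity → ContractibleTwistedDoubleStandard →
ResidualAcyclicBisectionRigidity → AcyclicBisectionRigidity` with the four route definitions
unfolded; proof by case analysis on planarity of the seam and contractibility of the halves,
compactness of `M` coming from the two compact embedded images. [folklore] -/
theorem convexBisection_acyclicRigidityBySectors :
    (∀ (M : Type) [TopologicalSpace M] [T2Space M] [SecondCountableTopology M] [ChartedSpace (EuclideanSpace ℝ (Fin 4)) M] [IsManifold (𝓡 4) ∞ M], M ≃ₕ Metric.sphere (0 : EuclideanSpace ℝ (Fin 5)) 1 → (∃ (W₁ : Type) (_ : TopologicalSpace W₁) (_ : ChartedSpace (EuclideanHalfSpace 4) W₁) (_ : IsManifold (𝓡∂ 4) ∞ W₁) (_ : CompactSpace W₁) (W₂ : Type) (_ : TopologicalSpace W₂) (_ : ChartedSpace (EuclideanHalfSpace 4) W₂) (_ : IsManifold (𝓡∂ 4) ∞ W₂) (_ : CompactSpace W₂) (J₁ : Literature.Geometry.Symplectic.SteinStructure W₁) (J₂ : Literature.Geometry.Symplectic.SteinStructure W₂) (e₁ : W₁ → M) (e₂ : W₂ → M), Manifold.IsSmoothEmbedding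 (𝓡∂ 4) (𝓡 4) ∞ e₁ ∧ Manifold.IsSmoothEmbedding (𝓡∂ 4) (𝓡 4) ∞ e₂ ∧ Set.range e₁ ∪ Set.range e₂ = Set.univ ∧ Set.range e₁ ∩ Set.range e₂ = e₁ '' (𝓡∂ 4).boundary W₁ ∧ Set.range e₁ ∩ Set.range e₂ = e₂ '' (𝓡∂ 4).boundary W₂ ∧ (∀ w₁ w₂, e₁ w₁ = e₂ w₂ → Submodule.map (mfderiv (𝓡∂ 4) (𝓡 4) e₁ w₁).toLinearMap (Literature.Geometry.Symplectic.contactPlane J₁.J w₁) = Submodule.map (mfderiv (𝓡∂ 4) (𝓡 4) e₂ w₂).toLinearMap (Literature.Geometry.Symplectic.contactPlane J₂.J w₂)) ∧ Literature.Geometry.Symplectic.PlanarContactBoundary J₁) → Nonempty (M ≃ₘ⟮𝓡 4, 𝓡 4⟯ Metric.sphere (0 : EuclideanSpace ℝ (Fin 5)) 1)) →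
    (∀ (X : Type) [TopologicalSpace X] [T2Space X] [SecondCountableTopology X] [CompactSpace X] [ChartedSpace (EuclideanSpace ℝ (Fin 4)) X] [IsManifold (𝓡 4) ∞ X] (W₁ : Type) [TopologicalSpace W₁] [ChartedSpace (EuclideanHalfSpace 4) W₁] [IsManifold (𝓡∂ 4) ∞ W₁] [CompactSpace W₁] [ContractibleSpace W₁] (W₂ : Type) [TopologicalSpace W₂] [ChartedSpace (EuclideanHalfSpace 4) W₂] [IsManifold (𝓡∂ 4) ∞ W₂] [CompactSpace W₂] [ContractibleSpace W₂] (J₁ : Literature.Geometry.Symplectic.SteinStructure W₁) (J₂ : Literature.Geometry.Symplectic.SteinStructure W₂) (e₁ : W₁ → X) (e₂ : W₂ → X), Manifold.IsSmoothEmbedding (𝓡∂ 4) (𝓡 4) ∞ e₁ → Manifold.IsSmoothEmbedding (𝓡∂ 4) (𝓡 4) ∞ e₂ → Set.range e₁ ∪ Set.range e₂ = Set.univ → Set.range e₁ ∩ Set.range e₂ = e₁ '' (𝓡∂ 4).boundary W₁ → Set.range e₁ ∩ Set.range e₂ = e₂ '' (𝓡∂ 4).boundary W₂ → (∀ w₁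 w₂, e₁ w₁ = e₂ w₂ → Submodule.map (mfderiv (𝓡∂ 4) (𝓡 4) e₁ w₁).toLinearMap (Literature.Geometry.Symplectic.contactPlane J₁.J w₁) = Submodule.map (mfderiv (𝓡∂ 4) (𝓡 4) e₂ w₂).toLinearMap (Literature.Geometry.Symplectic.contactPlane J₂.J w₂)) → Nonempty (X ≃ₘ⟮𝓡 4, 𝓡 4⟯ Metric.sphere (0 : EuclideanSpace ℝ (Fin 5)) 1)) →
    (∀ (M : Type) [TopologicalSpace M] [T2Space M] [SecondCountableTopology M] [ChartedSpace (EuclideanSpace ℝ (Fin 4)) M] [IsManifold (𝓡 4) ∞ M], M ≃ₕ Metric.sphere (0 : EuclideanSpace ℝ (Fin 5)) 1 → (∃ (W₁ : Type) (_ : TopologicalSpace W₁) (_ : ChartedSpace (EuclideanHalfSpace 4) W₁) (_ : IsManifold (𝓡∂ 4) ∞ W₁) (_ : CompactSpace W₁) (W₂ : Type) (_ : TopologicalSpace W₂) (_ : ChartedSpace (EuclideanHalfSpace 4) W₂) (_ : IsManifold (𝓡∂ 4) ∞ W₂) (_ : CompactSpace W₂) (J₁ : Literature.Geometry.Symplectic.SteinStructure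 W₁) (J₂ : Literature.Geometry.Symplectic.SteinStructure W₂) (e₁ : W₁ → M) (e₂ : W₂ → M), Manifold.IsSmoothEmbedding (𝓡∂ 4) (𝓡 4) ∞ e₁ ∧ Manifold.IsSmoothEmbedding (𝓡∂ 4) (𝓡 4) ∞ e₂ ∧ Set.range e₁ ∪ Set.range e₂ = Set.univ ∧ Set.range e₁ ∩ Set.range e₂ = e₁ '' (𝓡∂ 4).boundary W₁ ∧ Set.range e₁ ∩ Set.range e₂ = e₂ '' (𝓡∂ 4).boundary W₂ ∧ (∀ w₁ w₂, e₁ w₁ = e₂ w₂ → Submodule.map (mfderiv (𝓡∂ 4) (𝓡 4) e₁ w₁).toLinearMap (Literature.Geometry.Symplectic.contactPlane J₁.J w₁) = Submodule.map (mfderiv (𝓡∂ 4) (𝓡 4) e₂ w₂).toLinearMap (Literature.Geometry.Symplectic.contactPlane J₂.J w₂)) ∧ (∀ k, 0 < k → CategoryTheory.Limits.IsZero (Literature.AlgebraicTopology.SingularHomology.singularHomology ℚ ℚ W₁ k) ∧ CategoryTheory.Limits.IsZero (Literature.AlgebraicTopology.SingularHomology.singularHomology ℚ ℚ W₂ k))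 ∧ ¬ Literature.Geometry.Symplectic.PlanarContactBoundary J₁ ∧ ¬ (ContractibleSpace W₁ ∧ ContractibleSpace W₂)) → Nonempty (M ≃ₘ⟮𝓡 4, 𝓡 4⟯ Metric.sphere (0 : EuclideanSpace ℝ (Fin 5)) 1)) →
    (∀ (M : Type) [TopologicalSpace M] [T2Space M] [SecondCountableTopology M] [ChartedSpace (EuclideanSpace ℝ (Fin 4)) M] [IsManifold (𝓡 4) ∞ M], M ≃ₕ Metric.sphere (0 : EuclideanSpace ℝ (Fin 5)) 1 → (∃ (W₁ : Type) (_ : TopologicalSpace W₁) (_ : ChartedSpace (EuclideanHalfSpace 4) W₁) (_ : IsManifold (𝓡∂ 4) ∞ W₁) (_ : CompactSpace W₁) (W₂ : Type) (_ : TopologicalSpace W₂) (_ : ChartedSpace (EuclideanHalfSpace 4) W₂) (_ : IsManifold (𝓡∂ 4) ∞ W₂) (_ : CompactSpace W₂) (J₁ : Literature.Geometry.Symplectic.SteinStructure W₁) (J₂ : Literature.Geometry.Symplectic.SteinStructure W₂) (e₁ : W₁ → M) (e₂ : W₂ → M), Manifold.IsSmoothEmbedding (𝓡∂ 4) (𝓡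 4) ∞ e₁ ∧ Manifold.IsSmoothEmbedding (𝓡∂ 4) (𝓡 4) ∞ e₂ ∧ Set.range e₁ ∪ Set.range e₂ = Set.univ ∧ Set.range e₁ ∩ Set.range e₂ = e₁ '' (𝓡∂ 4).boundary W₁ ∧ Set.range e₁ ∩ Set.range e₂ = e₂ '' (𝓡∂ 4).boundary W₂ ∧ (∀ w₁ w₂, e₁ w₁ = e₂ w₂ → Submodule.map (mfderiv (𝓡∂ 4) (𝓡 4) e₁ w₁).toLinearMap (Literature.Geometry.Symplectic.contactPlane J₁.J w₁) = Submodule.map (mfderiv (𝓡∂ 4) (𝓡 4) e₂ w₂).toLinearMap (Literature.Geometry.Symplectic.contactPlane J₂.J w₂)) ∧ (∀ k, 0 < k → CategoryTheory.Limits.IsZero (Literature.AlgebraicTopology.SingularHomology.singularHomology ℚ ℚ W₁ k) ∧ CategoryTheory.Limits.IsZero (Literature.AlgebraicTopology.SingularHomology.singularHomology ℚ ℚ W₂ k))) → Nonempty (M ≃ₘ⟮𝓡 4, 𝓡 4⟯ Metric.sphere (0 : EuclideanSpace ℝ (Fin 5)) 1)) := by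
  intro hP hC hS M _ _ _ _ _ e hb
  obtain ⟨W₁, _, _, _, _, W₂, _, _, _, _, J₁, J₂, e₁, e₂, h₁, h₂, hcov, hs₁, hs₂, hξ, hacyc⟩ := hb
  by_cases hp : Literature.Geometry.Symplectic.PlanarContactBoundary J₁
  · exact hP M e ⟨W₁, _, _, _, _, W₂, _, _, _, _, J₁, J₂, e₁, e₂, h₁, h₂, hcov, hs₁, hs₂, hξ, hp⟩
  by_cases hc : ContractibleSpace W₁ ∧ ContractibleSpace W₂
  · obtain ⟨hc₁, hc₂⟩ := hc
    -- `M = e₁(W₁) ∪ e₂(W₂)` is compact as the union of two compact images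
    haveI : CompactSpace M := isCompact_univ_iff.mp (hcov ▸
      ((isCompact_range h₁.isEmbedding.continuous).union
        (isCompact_range h₂.isEmbedding.continuous)))
    exact hC M W₁ W₂ J₁ J₂ e₁ e₂ h₁ h₂ hcov hs₁ hs₂ hξ
  · exact hS M e
      ⟨W₁, _, _, _, _, W₂, _, _, _, _, J₁, J₂, e₁, e₂, h₁, h₂, hcov, hs₁, hs₂, hξ, hacyc, hp, hc⟩

end Summit.SmoothPoincare4.SmoothPoincare4.Theorems
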